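import Summits.ResolutionOfSingularities.ResolutionOfSingularities.Theorems.HomologicalConductorNoZenoTraceSocleCurveConfined
import Literature.AlgebraicGeometry.Resolution.TranscendenceDefect
import HarnessLib

/-!
# Crux `NoZenoR` / `NoZeno` (stmt-ResolutionOfSingularities-19943 / -16483), β1 layer:
# TRACE-SOCLE — THEOREM A in DEF-FREE «PAIRWISE-DEPENDENT RESIDUES» form (`Sig.CurveTraceTerminates` of
# strategist res-L0-w44-strat-1's line `confined-surface` r1, PROVED verbatim)

`[OURS · L W4.4]` Cell res-hironaka, crux chain W4.4, seat res-L0-w44-stub-1 g8; support-level, counted 0.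
Nothing here is a statement of the manuscript under review (Hironaka 2017); AI-written, weaker than expert review.
The bridge «a transcendence basis of `k(S)` can be chosen inside the generating set `S`» (Mathlib's
`exists_isTranscendenceBasis_subset` for the algebraic extension `k(S) / k[S]`) turns idea-1's THEOREM A
(`TraceSocle.curveConfined_terminates`, hypothesis `tr.deg_k k(res_W T_m₁) ≤ 1`) into the strategist's FACT 4
`Sig.CurveTraceTerminates` (`L/res-L0-w44-strat-1/line-confined-surface-r1.lean` sha16 `2e9a6b4082d4a94d`
l.335), whose hypothesis is «every two stage-`m₁` elements have `k`-algebraically DEPENDENT `W`-residues», spelled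
valuation-theoretically (`∃ f ≠ 0, W.valuation (f(a, b)) ≠ 1`).

* `trdeg_adjoin_le_one_of_pairwise_dependent` — `S ⊆ E` with no `k`-algebraically independent PAIR ⇒
  `tr.deg_k k(S) ≤ 1`.
* `not_algebraicIndependent_residue_pair` — a non-zero `f ∈ k[X, Y]` with `W.valuation (f(a, b)) ≠ 1` witnesses
  the dependence of the residues of `a, b ∈ W` (contrapositive of the tree's `valuation_aeval_eq_one`).
* **`curveTrace_terminates`** — `Sig.CurveTraceTerminates`, TEXT VERBATIM: a threadless tower (radical persistence,
  `StrictDrop`) confined by `W` from stage `m₁` (`T_m₁ ⊆ W`, escape witness, later stages in `loc W T_m₁`) with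
  pairwise residually dependent stage-`m₁` elements has a regular stage.

References: O. Zariski, P. Samuel, *Commutative Algebra* II (1960), VI [`ZariskiSamuel1960`] (background); the
mechanism is idea-1's card 10 (tree `…TraceSocleCurveConfined`).
-/

noncomputable section

-- single-problem summit: the doubled namespace component `ResolutionOfSingularities` is forced
set_option linter.dupNamespace false

namespace Summit.ResolutionOfSingularities.ResolutionOfSingularities.Theorems.NoZeno.TraceSocle

open Summit.ResolutionOfSingularities.ResolutionOfSingularities.Theses.HomologicalConductor
open Summit.ResolutionOfSingularities.ResolutionOfSingularities.Theorems.NoZeno.Birth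
open Summit.ResolutionOfSingularities.ResolutionOfSingularities.Theorems.NoZeno.SandwichCluster.Parasite
open Summit.ResolutionOfSingularities.ResolutionOfSingularities.Theorems
open Summit.ResolutionOfSingularities.ResolutionOfSingularities.Theorems.NoZeno
open Literature.AlgebraicGeometry.Resolution
open IsLocalRing

variable {k K : Type} [Field k] [Field K] [Algebra k K]

open scoped IntermediateField.algebraAdjoinAdjoin

/-! ## A transcendence basis inside the generating set -/

/-- **`tr.deg_k k(S) ≤ 1` when no two elements of `S` are algebraically independent over `k`**: a transcendence
basis of `k(S)/k` can be chosen inside `S` (`exists_isTranscendenceBasis_subset`, `k(S)` being algebraic over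
`k[S]`), and it has at most one element. [folklore] -/
theorem trdeg_adjoin_le_one_of_pairwise_dependent {E : Type} [Field E] [Algebra k E] (S : Set E)
    (h : ∀ u ∈ S, ∀ v ∈ S, ¬ AlgebraicIndependent k ![u, v]) :
    Algebra.trdeg k ↥(IntermediateField.adjoin k S) ≤ 1 := by
  classical
  set F : IntermediateField k E := IntermediateField.adjoin k S with hFdef
  let S' : Set ↥F := {x | (x : E) ∈ S}
  -- `F = k(S)` is algebraic over `k[S'] ≅ k[S]`
  have hmap : Subalgebra.map F.val (Algebra.adjoin k S') = Algebra.adjoin k S := by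
    rw [AlgHom.map_adjoin]
    congr 1
    ext u
    constructor
    · rintro ⟨x, hx, rfl⟩; exact hx
    · intro hu; exact ⟨⟨u, IntermediateField.subset_adjoin k S hu⟩, hu, rfl⟩
  let e : ↥(Algebra.adjoin k S') ≃ₐ[k] ↥(Algebra.adjoin k S) :=
    (Subalgebra.equivMapOfInjective _ F.val Subtype.val_injective).trans (Subalgebra.equivOfEq _ _ hmap)
  haveI : Algebra.IsAlgebraic ↥(Algebra.adjoin k S') ↥F := by
    refine ⟨fun y => ?_⟩
    have hy : IsAlgebraic ↥(Algebra.adjoin k S) (y : ↥F) := Algebra.IsAlgebraic.isAlgebraic y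
    refine IsAlgebraic.of_ringHom_of_comp_eq (e : _ →+* _) (RingHom.id ↥F) (by simpa using hy)
      e.surjective Function.injective_id ?_
    ext x
    rfl
  obtain ⟨t, htS', ht⟩ := exists_isTranscendenceBasis_subset (R := k) (A := ↥F) S'
  -- two distinct basis elements would be an independent pair inside `S`
  have hsub : t.Subsingleton := by
    intro u hu v hv
    by_contra huv
    apply h (u : E) (htS' hu) (v : E) (htS' hv)
    have hinj : Function.Injective (![⟨u, hu⟩, ⟨v, hv⟩] : Fin 2 → ↥t) := by
      intro i j hij
      fin_cases i <;> fin_cases j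
      · rfl
      · exact absurd (congrArg (fun z : ↥t => (z : ↥F)) hij) huv
      · exact absurd (congrArg (fun z : ↥t => (z : ↥F)) hij).symm huv
      · rfl
    have h2 : AlgebraicIndependent k (fun i : Fin 2 => (((![⟨u, hu⟩, ⟨v, hv⟩] : Fin 2 → ↥t) i : ↥t) : ↥F)) :=
      ht.1.comp _ hinj
    have h3 := h2.map' (f := F.val) (by
      rintro x y hxy; exact Subtype.val_injective hxy)
    convert h3 using 1
    funext i
    fin_cases i <;> rfl
  calc Algebra.trdeg k ↥F = Cardinal.mk ↥t := ht.cardinalMk_eq_trdeg.symm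
    _ ≤ 1 := Cardinal.mk_le_one_iff_set_subsingleton.mpr hsub

/-- **A valuation-detected dependence of residues.**  If some non-zero `f ∈ k[X, Y]` has
`W.valuation (f(a, b)) ≠ 1`, the residues of `a, b ∈ W` are algebraically DEPENDENT over `k` (contrapositive of
`valuation_aeval_eq_one`: independent residues make every non-zero polynomial value a unit). [folklore] -/
theorem not_algebraicIndependent_residue_pair (W : ValuationSubring K) [Algebra k ↥W] [IsScalarTower k ↥W K]
    (a b : ↥W) (f : MvPolynomial (Fin 2) k) (hf : f ≠ 0)
    (hne : W.valuation (MvPolynomial.aeval ![(a : K), (b : K)] f) ≠ 1) :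
    ¬ AlgebraicIndependent k ![residue W a, residue W b] := by
  intro hind
  apply hne
  have hx : AlgebraicIndependent k fun i => residue W (![a, b] i) := by
    convert hind using 1
    funext i
    fin_cases i <;> rfl
  have h := valuation_aeval_eq_one W ![a, b] hx hf
  have hfun : (![(a : K), (b : K)] : Fin 2 → K) = fun i => ((![a, b] i : ↥W) : K) := by
    funext i
    fin_cases i <;> rfl
  rw [hfun]
  exact h

/-! ## `Sig.CurveTraceTerminates`, verbatim -/

/-- **THEOREM A, PAIRWISE-DEPENDENT-RESIDUES FORM — `Sig.CurveTraceTerminates` of strategist res-L0-w44-strat-1's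
line `confined-surface` r1 (`2e9a6b4082d4a94d` l.335), TEXT VERBATIM, PROVED.**  A threadless tower (radical
persistence, `StrictDrop`) along `O`, confined from stage `m₁` by a valuation ring `W` (`T_m₁ ⊆ W`, an escape
witness `s ∈ T_m₁` with `s⁻¹ ∈ W ∖ O`, every later stage inside `loc W T_m₁`) such that EVERY TWO elements of
`T_m₁` have `k`-algebraically dependent `W`-residues (a non-zero `f ∈ k[X,Y]` with `W.valuation (f(a,b)) ≠ 1`),
has a regular stage.  Proof: `k ⊆ T_m₁ ⊆ W`; the trace field `k(res_W T_m₁)` has transcendence degree `≤ 1`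
(`trdeg_adjoin_le_one_of_pairwise_dependent` + `not_algebraicIndependent_residue_pair`); conclude by idea-1's
THEOREM A `curveConfined_terminates`. [this work] -/
theorem curveTrace_terminates :
    ∀ (hP : PersistenceRadical) (hD : StrictDrop) (p : ℕ) (hp : p.Prime)
    (k K : Type) [Field k] [CharP k p] [Field K] [Algebra k K] (O : ValuationSubring K)
    (A : Subalgebra k K) (hk : ∀ c : k, algebraMap k K c ∈ O) (hA : A.FG)
    (hfr : IsFractionRing ↥A K) (hAO : A.toSubring ≤ O.toSubring)
    (hthr : ¬ SingularPrimeThread O A)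
    (W : ValuationSubring K) (m₁ : ℕ) (hWT : ∀ s ∈ tower O A m₁, s ∈ W)
    (hesc : ∃ s ∈ tower O A m₁, s⁻¹ ∈ W ∧ s⁻¹ ∉ O)
    (hconf : ∀ m : ℕ, m₁ ≤ m → tower O A m ≤ loc W (tower O A m₁))
    (hdep : ∀ a ∈ tower O A m₁, ∀ b ∈ tower O A m₁, ∃ f : MvPolynomial (Fin 2) k, f ≠ 0 ∧
      W.valuation (MvPolynomial.aeval ![a, b] f) ≠ 1),
    ∃ m : ℕ, IsRegularLocalRing ↥(tower O A m) := by
  intro hP hD p hp k K _ _ _ _ O A hk hA hfr hAO hthr W m₁ hWT hesc hconf hdep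
  have hkW : ∀ c : k, algebraMap k K c ∈ W := fun c => hWT _ ((tower O A m₁).algebraMap_mem c)
  letI : Algebra k ↥W := algebraOfMem k W hkW
  haveI : IsScalarTower k ↥W K := isScalarTower_algebraOfMem k W hkW
  refine curveConfined_terminates hP hD p hp k K O A hk hA hfr hAO hthr W m₁ hWT hesc hconf ?_
  apply trdeg_adjoin_le_one_of_pairwise_dependent
  rintro _ ⟨a, rfl⟩ _ ⟨b, rfl⟩
  obtain ⟨f, hf0, hf1⟩ := hdep (a : K) a.2 (b : K) b.2
  exact not_algebraicIndependent_residue_pair W ⟨(a : K), hWT _ a.2⟩ ⟨(b : K), hWT _ b.2⟩ f hf0 hf1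

end Summit.ResolutionOfSingularities.ResolutionOfSingularities.Theorems.NoZeno.TraceSocle

end
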